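import Summits.BirchSwinnertonDyer.BirchSwinnertonDyer.Theses.SignedBaseChange
import Summits.BirchSwinnertonDyer.BirchSwinnertonDyer.Theorems.SignedBaseChangeTwistPairGreenbergProductDivisibilityStubFrameDataBCSSplit
import Summits.BirchSwinnertonDyer.BirchSwinnertonDyer.Theorems.SignedBaseChangeTwistPairGreenbergProductDivisibilityCanonicalFrameData
import Literature.NumberTheory.EllipticCurves.BurungaleSkinnerTianWan2024.OrdinaryTwoVariableMainStatementTwistConductorProofs
import HarnessLib

/-!
# K1′ `TwistPairGreenbergProductDivisibilitySplit` (stmt-BirchSwinnertonDyer-20502) follows from the `∀`-frame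
# «⊇»-half of the Greenberg main conjecture for ONE newform (Burungale–Skinner–Tian–Wan, arXiv:2409.01350,
# Conj. 9.12 (b)) — the R3 glue of director ruling W-9 (iii) (route SignedBaseChange; helper `--supports` 20502;
# lead sbc-p1 g4)

State of the crux (director-bsd W-9, 2026-08-27T11:20Z): line `birth` v6 reduced K1′ to one open stub
(`stub_productDivisibilityBCSsplit` = the unprinted "Theorem A"), the provable periphery is landed (p523887,
p525261, p525981, p526772), and no typed supersingular Greenberg binder fires on SBC's locus (the Heegner package
`∀ ℓ ∣ N split` is disjoint from (spl); X7 excludes square-free `N`). The director's fallback R3 books the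
conjecture-grade input K1′ is the K-currency shadow of: the LOWER («⊇») half of the two-variable Greenberg main
conjecture for a single elliptic newform `g` of level `N`, `p ∤ 2N`, over an imaginary quadratic `K` with (ord)
`p = v v̄` and (coprime) `(N, D_K) = 1` — BSTW Conj. 9.12 (b) ("`(𝓛_p^Gr(g/L)) = ξ(X_Gr(g/L))` in
`Λ_L^ur ⊗ ℚ_p`, and even in `Λ_L^ur` for `p ≠ 2`"; store text `paper:arxiv-2409.01350` p0071, with the standing
hypotheses (ord), (coprime) of p0069/p0005), read in the tree's `∀`-frame currency EXACTLY as the tree's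
transcription of BSTW Thm. 9.24 (`thm924_greenberg_dvd_charIdealXGr₂_awayFromCyc_OPEN`) minus its four
regime hypotheses `Squarefree N`, (irr_L), (spl), `2 split ∨ 2 ∣ N`: for every Katz frame `LK` and every
reduction-type-free Greenberg frame `G` of `g` at the inverse generators and every compatible `J`, some non-zero
cyclotomic-variable `s` has `s · ch(X_Gr₂(E/K̃_∞))·𝒪_{ℂ_p}⟦T₁,T₂⟧ ⊆ (G)` (the `⊗ ℚ_p` equality gives `s = p^k`).

THIS FILE proves the glue `K1′ ⇐ that statement` with the statement as an explicit HYPOTHESIS binder (it is an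
open conjecture: not a Literature fact, not asserted here; the planner files it as a conjecture-grade route item
at the freeze end, and the closing proposal for K1′ is then `fun h ↦ <this theorem> h`). Proof: the landed
`∃`-half `SignedBaseChangeK1FrameDataBCSSplit.stub_frameDataBCSsplit` (p525981) supplies the package; the
hypothesis is applied to `(W, f)` and to the twist `(W′, f′)` over the SAME frame `(K, LK)`; for the twist the two
side conditions `p ∤ N′` and `(N′, D_K) = 1` are DERIVED from the package (`q ∣ d ⇒ q ≠ p, q ∤ D_K`; `D_K` odd
because `2` splits; `(N, D_K) = 1`; tree theorems `not_dvd_conductorNorm_quadraticTwist_of_not_dvd`,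
`isCoprime_conductorNorm_of_smul_eq_quadraticTwist`, `WeierstrassCurve.conductorNorm_smul`); the two one-factor
inclusions multiply (the three-line ideal algebra of `SignedBaseChangeK1Rung.span_C_mul_mul_le_of_le`, done inline so
that this file stays out of that module's import cone; `s = s₁ s₂ ≠ 0` in the domain `𝒪_{ℂ_p}⟦T₁⟧`). Pure bookkeeping over the tree's currency; asserts nothing about any curve. READING FLAG
inherited from the Thm. 9.24 transcription: `BSTW-924-conjugate-convention` (`XGr₂` is "unramified outside `v`").
-/

-- D-0017: single-problem summit, the namespace repeats the problem name by design.
set_option linter.dupNamespace false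
set_option autoImplicit false

namespace Summit.BirchSwinnertonDyer.BirchSwinnertonDyer.Theorems.SignedBaseChangeK1GlueR3

open Summit.BirchSwinnertonDyer.BirchSwinnertonDyer.Theses.SignedBaseChange
open NumberField IsDedekindDomain Field WeierstrassCurve
open Literature.NumberTheory.EllipticCurves Literature.NumberTheory.GaloisRepresentations
  Literature.NumberTheory.EllipticCurves.ModularForms
  Literature.NumberTheory.EllipticCurves.BurungaleSkinnerTianWan2024

/-- `d` is prime to `D_K` when every prime ramified in `ℚ(√d)` avoids `D_K` (the package conjunct of K1/K1′;
a prime `q ∣ d` is ramified, `RamifiedInQuadratic d q` by its first disjunct). -/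
theorem isCoprime_twistDisc_discr {d D : ℤ} {p : ℕ} {N : ℕ}
    (hram : ∀ q : ℕ, q.Prime → RamifiedInQuadratic d q → q ≠ p ∧ ¬ q ∣ N ∧ ¬ (q : ℤ) ∣ D) :
    IsCoprime d D := by
  rw [Int.isCoprime_iff_gcd_eq_one, Int.gcd_eq_natAbs]
  exact Nat.coprime_of_dvd fun q hq hqd hqD ↦
    (hram q hq (Or.inl (Int.natCast_dvd.mpr hqd))).2.2 (Int.natCast_dvd.mpr hqD)

/-- `p ∤ d` when every prime ramified in `ℚ(√d)` is `≠ p` (same package conjunct). -/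
theorem not_dvd_twistDisc {d D : ℤ} {p : ℕ} {N : ℕ} (hp : p.Prime)
    (hram : ∀ q : ℕ, q.Prime → RamifiedInQuadratic d q → q ≠ p ∧ ¬ q ∣ N ∧ ¬ (q : ℤ) ∣ D) :
    ¬ (p : ℤ) ∣ d :=
  fun h ↦ (hram p hp (Or.inl h)).1 rfl

/-- **The twist's level is prime to `p` and to `D_K`** (the two side conditions of the single-newform binder
for `(W′, f′)`), derived from the K1′ package: `W′` a model of `W^{(d)}` (`C • W′ = W^{(d)}`), `N′ = N_{W′}`,
`p ∤ N_W` (good reduction), `p ≠ 2`, `1 < d`, the ramification conjunct, `(N, D_K) = 1` and `D_K` odd. -/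
theorem twist_level_conditions {p : ℕ} (hp : p.Prime) (hp2 : p ≠ 2) (W W' : WeierstrassCurve ℚ)
    [W.IsElliptic] [W'.IsElliptic] {N N' : ℕ} (hN : (N : ℤ) = W.conductorNorm ℤ)
    (hN' : (N' : ℤ) = W'.conductorNorm ℤ) (hpN : ¬ p ∣ N) {d D : ℤ} (hd : 1 < d)
    (hram : ∀ q : ℕ, q.Prime → RamifiedInQuadratic d q → q ≠ p ∧ ¬ q ∣ N ∧ ¬ (q : ℤ) ∣ D)
    {C : WeierstrassCurve.VariableChange ℚ} (hC : C • W' = W.quadraticTwist (d : ℚ))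
    (hcop : IsCoprime (N : ℤ) D) (hodd : Odd D) :
    ¬ p ∣ N' ∧ IsCoprime (N' : ℤ) D := by
  have hNn : N = W.conductorNorm ℤ := by exact_mod_cast hN
  have hN'n : N' = W'.conductorNorm ℤ := by exact_mod_cast hN'
  have hd0 : d ≠ 0 := by omega
  have hpd : ¬ (p : ℤ) ∣ d := not_dvd_twistDisc hp hram
  have hNW' : W'.conductorNorm ℤ = (W.quadraticTwist (d : ℚ)).conductorNorm ℤ := by
    rw [← WeierstrassCurve.conductorNorm_smul ℤ W' C, hC]
  refine ⟨?_, ?_⟩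
  · rw [hN'n, hNW']
    exact not_dvd_conductorNorm_quadraticTwist_of_not_dvd W hp hp2 (hNn ▸ hpN) hd0 hpd
  · rw [hN'n]
    exact isCoprime_conductorNorm_of_smul_eq_quadraticTwist W W' hd0 hC hodd (hNn ▸ hcop)
      (isCoprime_twistDisc_discr hram)

/-- **R3 glue: K1′ ⇐ the `∀`-frame «⊇»-half of the Greenberg main conjecture for one newform (BSTW Conj. 9.12 (b)
in the currency of the tree's Thm. 9.24 transcription, without `Squarefree N`, (irr_L), (spl), (2)).** The
hypothesis `hGr` reads: for every globally minimal `W/ℚ` with newform `f` of level `N = N_W`, every prime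
`p ∤ 2N`, every imaginary quadratic `K` with `p = v v̄` split (`v` induced by `ι`) and `(N, D_K) = 1`, the
cyclotomic/anticyclotomic `ℤ_p²`-tower with a generator pair, EVERY Katz frame `(Ω, δ, Ω_p, LK)` and EVERY
Greenberg frame `G` of `f` over `LK` at the inverse generators, and every compatible `J : ℤ_p → 𝒪_{ℂ_p}`: some
`s ∈ 𝒪_{ℂ_p}⟦T₁⟧ ∖ 0` has `(C s) · ch(X_Gr₂(W/K)) 𝒪_{ℂ_p}⟦T₁,T₂⟧ ⊆ (G)`. Conclusion: the route decl
`TwistPairGreenbergProductDivisibilitySplit` (K1′), by applying `hGr` to `(W, f)` and `(W′, f′)` over the frame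
produced by `stub_frameDataBCSsplit` and multiplying. -/
theorem twistPairGreenbergProductDivisibilitySplit_of_greenbergLowerHalf
    (hGr : ∀ {p : ℕ} [Fact p.Prime] (ι : PadicAlgCl p ≃+* ℂ) (W : WeierstrassCurve ℚ) [W.IsElliptic] [W.IsGloballyMinimal] (K : Type) [Field K] [NumberField K] (v vbar : IsDedekindDomain.HeightOneSpectrum (NumberField.RingOfIntegers K)) (κ₁ κ₂ : Literature.NumberTheory.EllipticCurves.ZpExtension K p) (γ₁ γ₂ : Field.absoluteGaloisGroup K) [Fact (Literature.NumberTheory.EllipticCurves.ZpExtension.IsTopGeneratorPair κ₁ κ₂ γ₁ γ₂)] {N : ℕ} [NeZero N] {f : CuspForm (CongruenceSubgroup.Gamma0 N) 2} (_ : Literature.NumberTheory.EllipticCurves.ModularForms.IsNewformOf W f) [NeZero (NumberField.discr K).natAbs], (N : ℤ) = W.conductorNorm ℤ → p ≠ 2 → ¬ p ∣ N → Literature.NumberTheory.EllipticCurves.IsImaginaryQuadratic K → ((Ideal.span {(p : ℤ)}).primesOver (NumberField.RingOfIntegers K)).ncard = 2 → ((p : ℕ) : NumberField.RingOfIntegers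 K) ∈ v.asIdeal → ((p : ℕ) : NumberField.RingOfIntegers K) ∈ vbar.asIdeal → vbar ≠ v → (∀ (w : NumberField.InfinitePlace K) (k : NumberField.RingOfIntegers K), k ∈ v.asIdeal ↔ ‖ι.symm (w.embedding (k : K))‖ < 1) → IsCoprime (N : ℤ) (NumberField.discr K) → κ₁.IsCyclotomic → κ₂.IsAnticyclotomic → ∀ (Ω δ : ℂ) (Ωp : (Literature.NumberTheory.EllipticCurves.unrIntegers p)ˣ) (LK G : PowerSeries (PowerSeries (PadicComplexInt p))), Ω ≠ 0 → (δ ^ 2 = (NumberField.discr K : ℂ) ∨ δ ^ 2 = -(NumberField.discr K : ℂ)) → Literature.NumberTheory.EllipticCurves.IsKatzMeasure₂ ι v vbar ∅ κ₁ κ₂ γ₁⁻¹ γ₂⁻¹ 1 Ω δ ((Ωp : Literature.NumberTheory.EllipticCurves.unrIntegers p) : PadicComplex p) LK → Literature.NumberTheory.EllipticCurves.IsGreenbergLFunctionAnyRoot₂ ι v vbar κ₁ κ₂ γ₁⁻¹ γ₂⁻¹ f (NumberField.discr K).natAbs (NumberField.classNumber K) LK G → ∀ J : ℤ_[p] →+*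 PadicComplexInt p, (∀ x : ℤ_[p], ((J x : PadicComplexInt p) : PadicComplex p) = ((x : ℚ_[p]) : PadicComplex p)) → ∃ s : PowerSeries (PadicComplexInt p), s ≠ 0 ∧ Ideal.span {PowerSeries.map (PowerSeries.C (R := PadicComplexInt p)) s} * (WeierstrassCurve.XGr₂.charIdeal (W.baseChange K) p κ₁ κ₂ vbar γ₁ γ₂).map (Literature.NumberTheory.EllipticCurves.IwasawaAlgebra₂.toUnr₂ p J) ≤ Ideal.span {G}) :
    TwistPairGreenbergProductDivisibilitySplit := by
  intro hmodP W _ _ p _ hp hX hs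
  obtain ⟨K, iF, iNF, ι, v, vbar, κ₁, κ₂, γ₁, γ₂, iPair, iD, N, iN, f, d, W', iE', iM', C, N', iN', f', h0, h1,
      h2, h3, h4, h5, h6, h7, h8, h9, h10, h11, h12, h13, h14, h15, h16, h17, e1, e2, e3, e4, e5, e6, e7⟩ :=
    Summit.BirchSwinnertonDyer.BirchSwinnertonDyer.Theorems.SignedBaseChangeK1FrameDataBCSSplit.stub_frameDataBCSsplit
      hmodP W p hp hX hs
  have hpP : p.Prime := Fact.out
  have hp2 : p ≠ 2 := by omega
  have hpN : ¬ p ∣ N := by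
    have hNn : N = W.conductorNorm ℤ := by exact_mod_cast h1
    rw [hNn]
    exact not_dvd_conductorNorm_of_hasGoodReductionAtPrime W hX.1.1
  obtain ⟨hpN', h14'⟩ := twist_level_conditions hpP hp2 W W' h1 h3 hpN h5 h6 h7 h14 e3.1
  refine ⟨K, iF, iNF, ι, v, vbar, κ₁, κ₂, γ₁, γ₂, iPair, iD, N, iN, f, d, W', iE', iM', C, N', iN', f', h0, h1,
    h2, h3, h4, h5, h6, h7, h8, h9, h10, h11, h12, h13, h14, e1, e5, e2, h15, h16, h17, ?_⟩
  intro Ω δ Ωp LK G G' hΩ hδ hLK hG hG' J hJ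
  obtain ⟨s₁, hs₁, hA⟩ := hGr ι W K v vbar κ₁ κ₂ γ₁ γ₂ h0 h1 hp2 hpN h8 h9 h10 h11 h12 h13 h14 h16 h17
    Ω δ Ωp LK G hΩ hδ hLK hG J hJ
  obtain ⟨s₂, hs₂, hB⟩ := hGr ι W' K v vbar κ₁ κ₂ γ₁ γ₂ h2 h3 hp2 hpN' h8 h9 h10 h11 h12 h13 h14' h16 h17
    Ω δ Ωp LK G' hΩ hδ hLK hG' J hJ
  -- ideal algebra `(C s₁)(C s₂)·A·B ⊆ (G)(G') = (G·G')` (as in `SignedBaseChangeK1Rung.span_C_mul_mul_le_of_le`)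
  refine ⟨s₁ * s₂, mul_ne_zero hs₁ hs₂, ?_⟩
  rw [map_mul, ← Ideal.span_singleton_mul_span_singleton, ← Ideal.span_singleton_mul_span_singleton,
    mul_mul_mul_comm]
  exact Ideal.mul_mono hA hB

/-! ### §2 (appended by the same seat, sbc-p1 g4): the glue against the planner's AGREED item text `A.sig`

The tenure planner penned the R3 package (`HOME/bsd-wall-ss/rev15-R3/`, bsd-wall-ss g3, 11:38Z; README-R3.md,
children.json ee62d9d7f82c3ff3, certificate R3Glue.lean d66b0dfd9c80e94d rc 0, BC7 crux probe CLEAN) with the item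
text `A.sig` (2072 chars) for the conjecture-grade child `GreenbergLowerHalfConj912` — the SAME `∀`-frame statement
as the binder `hGr` of §1 up to binder ORDER (`A.sig`: explicit `p`, then `W`, `K`, `ι`, …, explicit `N`, `f`, and
`IsNewformOf W f →` as an arrow; §1 followed the Thm. 9.24 transcription's order). Binder order is not definitional,
and the rule is ONE text (ss g3 11:52:46Z: "never two texts"), so §2 restates the glue against `A.sig` VERBATIM,
proves the two orderings equivalent (`conj912_of_greenbergLowerHalf`, `greenbergLowerHalf_of_conj912` — so §1 is
the same mathematics, not a second text), and lands the two by-products of the planner's certificate as tree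
theorems: the registered open stub of line `birth` v6 (`stub_productDivisibilityBCSsplit`, text verbatim as the
conclusion) follows from the item (`productDivisibilityBCSsplit_of_conj912`), hence K1′
(`twistPairGreenbergProductDivisibilitySplit_of_conj912`, the closing shape once the item exists:
`fun h ↦ twistPairGreenbergProductDivisibilitySplit_of_conj912 h`), and the item implies the tree's typed
Thm. 9.24 first-clause binder (`thm924_firstClause_of_conj912`: a pure weakening of antecedents — same currency
as the accepted OPEN binder, so no new carrier enters the route). Nothing here asserts the conjecture. -/

/-- The Thm. 9.24-ordered form of the lower-half statement (§1's `hGr`) implies the planner's `A.sig` form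
(binder reshuffle only). -/
theorem conj912_of_greenbergLowerHalf
    (hGr : ∀ {p : ℕ} [Fact p.Prime] (ι : PadicAlgCl p ≃+* ℂ) (W : WeierstrassCurve ℚ) [W.IsElliptic] [W.IsGloballyMinimal] (K : Type) [Field K] [NumberField K] (v vbar : IsDedekindDomain.HeightOneSpectrum (NumberField.RingOfIntegers K)) (κ₁ κ₂ : Literature.NumberTheory.EllipticCurves.ZpExtension K p) (γ₁ γ₂ : Field.absoluteGaloisGroup K) [Fact (Literature.NumberTheory.EllipticCurves.ZpExtension.IsTopGeneratorPair κ₁ κ₂ γ₁ γ₂)] {N : ℕ} [NeZero N] {f : CuspForm (CongruenceSubgroup.Gamma0 N) 2} (_ : Literature.NumberTheory.EllipticCurves.ModularForms.IsNewformOf W f) [NeZero (NumberField.discr K).natAbs], (N : ℤ) = W.conductorNorm ℤ → p ≠ 2 → ¬ p ∣ N → Literature.NumberTheory.EllipticCurves.IsImaginaryQuadratic K → ((Ideal.span {(p : ℤ)}).primesOver (NumberField.RingOfIntegers K)).ncard = 2 → ((p : ℕ) : NumberField.RingOfIntegers K) ∈ v.asIdeal → ((p : ℕ) : NumberField.RingOfIntegers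 K) ∈ vbar.asIdeal → vbar ≠ v → (∀ (w : NumberField.InfinitePlace K) (k : NumberField.RingOfIntegers K), k ∈ v.asIdeal ↔ ‖ι.symm (w.embedding (k : K))‖ < 1) → IsCoprime (N : ℤ) (NumberField.discr K) → κ₁.IsCyclotomic → κ₂.IsAnticyclotomic → ∀ (Ω δ : ℂ) (Ωp : (Literature.NumberTheory.EllipticCurves.unrIntegers p)ˣ) (LK G : PowerSeries (PowerSeries (PadicComplexInt p))), Ω ≠ 0 → (δ ^ 2 = (NumberField.discr K : ℂ) ∨ δ ^ 2 = -(NumberField.discr K : ℂ)) → Literature.NumberTheory.EllipticCurves.IsKatzMeasure₂ ι v vbar ∅ κ₁ κ₂ γ₁⁻¹ γ₂⁻¹ 1 Ω δ ((Ωp : Literature.NumberTheory.EllipticCurves.unrIntegers p) : PadicComplex p) LK → Literature.NumberTheory.EllipticCurves.IsGreenbergLFunctionAnyRoot₂ ι v vbar κ₁ κ₂ γ₁⁻¹ γ₂⁻¹ f (NumberField.discr K).natAbs (NumberField.classNumber K) LK G → ∀ J : ℤ_[p] →+* PadicComplexInt p, (∀ x : ℤ_[p], ((J x : PadicComplexInt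 p) : PadicComplex p) = ((x : ℚ_[p]) : PadicComplex p)) → ∃ s : PowerSeries (PadicComplexInt p), s ≠ 0 ∧ Ideal.span {PowerSeries.map (PowerSeries.C (R := PadicComplexInt p)) s} * (WeierstrassCurve.XGr₂.charIdeal (W.baseChange K) p κ₁ κ₂ vbar γ₁ γ₂).map (Literature.NumberTheory.EllipticCurves.IwasawaAlgebra₂.toUnr₂ p J) ≤ Ideal.span {G}) :
    ∀ (p : ℕ) [Fact p.Prime] (W : WeierstrassCurve ℚ) [W.IsElliptic] [W.IsGloballyMinimal] (K : Type) [Field K] [NumberField K] (ι : PadicAlgCl p ≃+* ℂ) (v vbar : IsDedekindDomain.HeightOneSpectrum (NumberField.RingOfIntegers K)) (κ₁ κ₂ : Literature.NumberTheory.EllipticCurves.ZpExtension K p) (γ₁ γ₂ : Field.absoluteGaloisGroup K) [Fact (Literature.NumberTheory.EllipticCurves.ZpExtension.IsTopGeneratorPair κ₁ κ₂ γ₁ γ₂)] [NeZero (NumberField.discr K).natAbs] (N : ℕ) [NeZero N] (f : CuspForm (CongruenceSubgroup.Gamma0 N) 2), Literature.NumberTheory.EllipticCurves.ModularForms.IsNewformOf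 W f → (N : ℤ) = W.conductorNorm ℤ → p ≠ 2 → ¬ p ∣ N → Literature.NumberTheory.EllipticCurves.IsImaginaryQuadratic K → ((Ideal.span {(p : ℤ)}).primesOver (NumberField.RingOfIntegers K)).ncard = 2 → ((p : ℕ) : NumberField.RingOfIntegers K) ∈ v.asIdeal → ((p : ℕ) : NumberField.RingOfIntegers K) ∈ vbar.asIdeal → vbar ≠ v → (∀ (w : NumberField.InfinitePlace K) (k : NumberField.RingOfIntegers K), k ∈ v.asIdeal ↔ ‖ι.symm (w.embedding (k : K))‖ < 1) → IsCoprime (N : ℤ) (NumberField.discr K) → κ₁.IsCyclotomic → κ₂.IsAnticyclotomic → ∀ (Ω δ : ℂ) (Ωp : (Literature.NumberTheory.EllipticCurves.unrIntegers p)ˣ) (LK G : PowerSeries (PowerSeries (PadicComplexInt p))), Ω ≠ 0 → (δ ^ 2 = (NumberField.discr K : ℂ) ∨ δ ^ 2 = -(NumberField.discr K : ℂ)) → Literature.NumberTheory.EllipticCurves.IsKatzMeasure₂ ι v vbar ∅ κ₁ κ₂ γ₁⁻¹ γ₂⁻¹ 1 Ω δ ((Ωp : Literature.NumberTheory.EllipticCurves.unrIntegers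 p) : PadicComplex p) LK → Literature.NumberTheory.EllipticCurves.IsGreenbergLFunctionAnyRoot₂ ι v vbar κ₁ κ₂ γ₁⁻¹ γ₂⁻¹ f (NumberField.discr K).natAbs (NumberField.classNumber K) LK G → ∀ J : ℤ_[p] →+* PadicComplexInt p, (∀ x : ℤ_[p], ((J x : PadicComplexInt p) : PadicComplex p) = ((x : ℚ_[p]) : PadicComplex p)) → ∃ s : PowerSeries (PadicComplexInt p), s ≠ 0 ∧ Ideal.span {PowerSeries.map (PowerSeries.C (R := PadicComplexInt p)) s} * (WeierstrassCurve.XGr₂.charIdeal (W.baseChange K) p κ₁ κ₂ vbar γ₁ γ₂).map (Literature.NumberTheory.EllipticCurves.IwasawaAlgebra₂.toUnr₂ p J) ≤ Ideal.span {G} := by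
  intro p _ W _ _ K _ _ ι v vbar κ₁ κ₂ γ₁ γ₂ _ _ N _ f hf hN hp2 hpN hK hsplit hv hvbar hvv hι hcop hκ₁ hκ₂
    Ω δ Ωp LK G hΩ hδ hLK hG J hJ
  exact hGr ι W K v vbar κ₁ κ₂ γ₁ γ₂ hf hN hp2 hpN hK hsplit hv hvbar hvv hι hcop hκ₁ hκ₂ Ω δ Ωp LK G hΩ hδ hLK
    hG J hJ

/-- The planner's `A.sig` form implies the Thm. 9.24-ordered form (binder reshuffle only); with the previous
theorem the two texts are EQUIVALENT, i.e. §1 and §2 are one statement. -/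
theorem greenbergLowerHalf_of_conj912
    (hA : ∀ (p : ℕ) [Fact p.Prime] (W : WeierstrassCurve ℚ) [W.IsElliptic] [W.IsGloballyMinimal] (K : Type) [Field K] [NumberField K] (ι : PadicAlgCl p ≃+* ℂ) (v vbar : IsDedekindDomain.HeightOneSpectrum (NumberField.RingOfIntegers K)) (κ₁ κ₂ : Literature.NumberTheory.EllipticCurves.ZpExtension K p) (γ₁ γ₂ : Field.absoluteGaloisGroup K) [Fact (Literature.NumberTheory.EllipticCurves.ZpExtension.IsTopGeneratorPair κ₁ κ₂ γ₁ γ₂)] [NeZero (NumberField.discr K).natAbs] (N : ℕ) [NeZero N] (f : CuspForm (CongruenceSubgroup.Gamma0 N) 2), Literature.NumberTheory.EllipticCurves.ModularForms.IsNewformOf W f → (N : ℤ) = W.conductorNorm ℤ → p ≠ 2 → ¬ p ∣ N → Literature.NumberTheory.EllipticCurves.IsImaginaryQuadratic K → ((Ideal.span {(p : ℤ)}).primesOver (NumberField.RingOfIntegers K)).ncard = 2 → ((p : ℕ) : NumberField.RingOfIntegers K) ∈ v.asIdeal → ((p : ℕ) : NumberField.RingOfIntegers K) ∈ vbar.asIdeal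 → vbar ≠ v → (∀ (w : NumberField.InfinitePlace K) (k : NumberField.RingOfIntegers K), k ∈ v.asIdeal ↔ ‖ι.symm (w.embedding (k : K))‖ < 1) → IsCoprime (N : ℤ) (NumberField.discr K) → κ₁.IsCyclotomic → κ₂.IsAnticyclotomic → ∀ (Ω δ : ℂ) (Ωp : (Literature.NumberTheory.EllipticCurves.unrIntegers p)ˣ) (LK G : PowerSeries (PowerSeries (PadicComplexInt p))), Ω ≠ 0 → (δ ^ 2 = (NumberField.discr K : ℂ) ∨ δ ^ 2 = -(NumberField.discr K : ℂ)) → Literature.NumberTheory.EllipticCurves.IsKatzMeasure₂ ι v vbar ∅ κ₁ κ₂ γ₁⁻¹ γ₂⁻¹ 1 Ω δ ((Ωp : Literature.NumberTheory.EllipticCurves.unrIntegers p) : PadicComplex p) LK → Literature.NumberTheory.EllipticCurves.IsGreenbergLFunctionAnyRoot₂ ι v vbar κ₁ κ₂ γ₁⁻¹ γ₂⁻¹ f (NumberField.discr K).natAbs (NumberField.classNumber K) LK G → ∀ J : ℤ_[p] →+* PadicComplexInt p, (∀ x : ℤ_[p], ((J x : PadicComplexInt p) : PadicComplex p) = ((x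 : ℚ_[p]) : PadicComplex p)) → ∃ s : PowerSeries (PadicComplexInt p), s ≠ 0 ∧ Ideal.span {PowerSeries.map (PowerSeries.C (R := PadicComplexInt p)) s} * (WeierstrassCurve.XGr₂.charIdeal (W.baseChange K) p κ₁ κ₂ vbar γ₁ γ₂).map (Literature.NumberTheory.EllipticCurves.IwasawaAlgebra₂.toUnr₂ p J) ≤ Ideal.span {G}) :
    ∀ {p : ℕ} [Fact p.Prime] (ι : PadicAlgCl p ≃+* ℂ) (W : WeierstrassCurve ℚ) [W.IsElliptic] [W.IsGloballyMinimal] (K : Type) [Field K] [NumberField K] (v vbar : IsDedekindDomain.HeightOneSpectrum (NumberField.RingOfIntegers K)) (κ₁ κ₂ : Literature.NumberTheory.EllipticCurves.ZpExtension K p) (γ₁ γ₂ : Field.absoluteGaloisGroup K) [Fact (Literature.NumberTheory.EllipticCurves.ZpExtension.IsTopGeneratorPair κ₁ κ₂ γ₁ γ₂)] {N : ℕ} [NeZero N] {f : CuspForm (CongruenceSubgroup.Gamma0 N) 2} (_ : Literature.NumberTheory.EllipticCurves.ModularForms.IsNewformOf W f) [NeZero (NumberField.discr K).natAbs], (N :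 ℤ) = W.conductorNorm ℤ → p ≠ 2 → ¬ p ∣ N → Literature.NumberTheory.EllipticCurves.IsImaginaryQuadratic K → ((Ideal.span {(p : ℤ)}).primesOver (NumberField.RingOfIntegers K)).ncard = 2 → ((p : ℕ) : NumberField.RingOfIntegers K) ∈ v.asIdeal → ((p : ℕ) : NumberField.RingOfIntegers K) ∈ vbar.asIdeal → vbar ≠ v → (∀ (w : NumberField.InfinitePlace K) (k : NumberField.RingOfIntegers K), k ∈ v.asIdeal ↔ ‖ι.symm (w.embedding (k : K))‖ < 1) → IsCoprime (N : ℤ) (NumberField.discr K) → κ₁.IsCyclotomic → κ₂.IsAnticyclotomic → ∀ (Ω δ : ℂ) (Ωp : (Literature.NumberTheory.EllipticCurves.unrIntegers p)ˣ) (LK G : PowerSeries (PowerSeries (PadicComplexInt p))), Ω ≠ 0 → (δ ^ 2 = (NumberField.discr K : ℂ) ∨ δ ^ 2 = -(NumberField.discr K : ℂ)) → Literature.NumberTheory.EllipticCurves.IsKatzMeasure₂ ι v vbar ∅ κ₁ κ₂ γ₁⁻¹ γ₂⁻¹ 1 Ω δ ((Ωp : Literature.NumberTheory.EllipticCurves.unrIntegers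 p) : PadicComplex p) LK → Literature.NumberTheory.EllipticCurves.IsGreenbergLFunctionAnyRoot₂ ι v vbar κ₁ κ₂ γ₁⁻¹ γ₂⁻¹ f (NumberField.discr K).natAbs (NumberField.classNumber K) LK G → ∀ J : ℤ_[p] →+* PadicComplexInt p, (∀ x : ℤ_[p], ((J x : PadicComplexInt p) : PadicComplex p) = ((x : ℚ_[p]) : PadicComplex p)) → ∃ s : PowerSeries (PadicComplexInt p), s ≠ 0 ∧ Ideal.span {PowerSeries.map (PowerSeries.C (R := PadicComplexInt p)) s} * (WeierstrassCurve.XGr₂.charIdeal (W.baseChange K) p κ₁ κ₂ vbar γ₁ γ₂).map (Literature.NumberTheory.EllipticCurves.IwasawaAlgebra₂.toUnr₂ p J) ≤ Ideal.span {G} := by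
  intro p _ ι W _ _ K _ _ v vbar κ₁ κ₂ γ₁ γ₂ _ N _ f hf _ hN hp2 hpN hK hsplit hv hvbar hvv hι hcop hκ₁ hκ₂
    Ω δ Ωp LK G hΩ hδ hLK hG J hJ
  exact hA p W K ι v vbar κ₁ κ₂ γ₁ γ₂ N f hf hN hp2 hpN hK hsplit hv hvbar hvv hι hcop hκ₁ hκ₂ Ω δ Ωp LK G hΩ hδ
    hLK hG J hJ

/-- **The registered open stub of line `birth` v6 ⇐ the R3 item.** `stub_productDivisibilityBCSsplit` (skeleton
4fc4445231293d68 on stmt-BirchSwinnertonDyer-20502; text VERBATIM as the conclusion) from `A.sig` applied to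
`(W, f)` and to `(W′, f′)` on the common frame; `p ∤ N′` and `(N′, D_K) = 1` by `twist_level_conditions` (§1).
(Same proof as the planner's certificate `R3Glue.productDivisibilityBCSsplit_of_greenbergLowerHalf`.) -/
theorem productDivisibilityBCSsplit_of_conj912
    (hA : ∀ (p : ℕ) [Fact p.Prime] (W : WeierstrassCurve ℚ) [W.IsElliptic] [W.IsGloballyMinimal] (K : Type) [Field K] [NumberField K] (ι : PadicAlgCl p ≃+* ℂ) (v vbar : IsDedekindDomain.HeightOneSpectrum (NumberField.RingOfIntegers K)) (κ₁ κ₂ : Literature.NumberTheory.EllipticCurves.ZpExtension K p) (γ₁ γ₂ : Field.absoluteGaloisGroup K) [Fact (Literature.NumberTheory.EllipticCurves.ZpExtension.IsTopGeneratorPair κ₁ κ₂ γ₁ γ₂)] [NeZero (NumberField.discr K).natAbs] (N : ℕ) [NeZero N] (f : CuspForm (CongruenceSubgroup.Gamma0 N) 2), Literature.NumberTheory.EllipticCurves.ModularForms.IsNewformOf W f → (N : ℤ) = W.conductorNorm ℤ → p ≠ 2 → ¬ p ∣ N → Literature.NumberTheory.EllipticCurves.IsImaginaryQuadratic K → ((Ideal.span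 {(p : ℤ)}).primesOver (NumberField.RingOfIntegers K)).ncard = 2 → ((p : ℕ) : NumberField.RingOfIntegers K) ∈ v.asIdeal → ((p : ℕ) : NumberField.RingOfIntegers K) ∈ vbar.asIdeal → vbar ≠ v → (∀ (w : NumberField.InfinitePlace K) (k : NumberField.RingOfIntegers K), k ∈ v.asIdeal ↔ ‖ι.symm (w.embedding (k : K))‖ < 1) → IsCoprime (N : ℤ) (NumberField.discr K) → κ₁.IsCyclotomic → κ₂.IsAnticyclotomic → ∀ (Ω δ : ℂ) (Ωp : (Literature.NumberTheory.EllipticCurves.unrIntegers p)ˣ) (LK G : PowerSeries (PowerSeries (PadicComplexInt p))), Ω ≠ 0 → (δ ^ 2 = (NumberField.discr K : ℂ) ∨ δ ^ 2 = -(NumberField.discr K : ℂ)) → Literature.NumberTheory.EllipticCurves.IsKatzMeasure₂ ι v vbar ∅ κ₁ κ₂ γ₁⁻¹ γ₂⁻¹ 1 Ω δ ((Ωp : Literature.NumberTheory.EllipticCurves.unrIntegers p) : PadicComplex p) LK → Literature.NumberTheory.EllipticCurves.IsGreenbergLFunctionAnyRoot₂ ι v vbar κ₁ κ₂ γ₁⁻¹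 γ₂⁻¹ f (NumberField.discr K).natAbs (NumberField.classNumber K) LK G → ∀ J : ℤ_[p] →+* PadicComplexInt p, (∀ x : ℤ_[p], ((J x : PadicComplexInt p) : PadicComplex p) = ((x : ℚ_[p]) : PadicComplex p)) → ∃ s : PowerSeries (PadicComplexInt p), s ≠ 0 ∧ Ideal.span {PowerSeries.map (PowerSeries.C (R := PadicComplexInt p)) s} * (WeierstrassCurve.XGr₂.charIdeal (W.baseChange K) p κ₁ κ₂ vbar γ₁ γ₂).map (Literature.NumberTheory.EllipticCurves.IwasawaAlgebra₂.toUnr₂ p J) ≤ Ideal.span {G}) :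
    ∀ (W : WeierstrassCurve ℚ) [W.IsElliptic] [W.IsGloballyMinimal] (p : ℕ) [Fact p.Prime], 5 ≤ p → Literature.NumberTheory.EllipticCurves.Rank1Residual.ClassX7 W p → Literature.NumberTheory.EllipticCurves.Rank1Residual.Surj W p → ∀ (K : Type) [Field K] [NumberField K] (ι : PadicAlgCl p ≃+* ℂ) (v vbar : IsDedekindDomain.HeightOneSpectrum (NumberField.RingOfIntegers K)) (κ₁ κ₂ : Literature.NumberTheory.EllipticCurves.ZpExtension K p) (γ₁ γ₂ : Field.absoluteGaloisGroup K) [Fact (Literature.NumberTheory.EllipticCurves.ZpExtension.IsTopGeneratorPair κ₁ κ₂ γ₁ γ₂)] [NeZero (NumberField.discr K).natAbs] (N : ℕ) [NeZero N] (f : CuspForm (CongruenceSubgroup.Gamma0 N) 2) (d : ℤ) (W' : WeierstrassCurve ℚ) [W'.IsElliptic] [W'.IsGloballyMinimal] (C : WeierstrassCurve.VariableChange ℚ) (N' : ℕ) [NeZero N'] (f' : CuspForm (CongruenceSubgroup.Gamma0 N') 2), Literature.NumberTheory.EllipticCurves.ModularForms.IsNewformOf W f → (N : ℤ) = W.conductorNorm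 ℤ → Literature.NumberTheory.EllipticCurves.ModularForms.IsNewformOf W' f' → (N' : ℤ) = W'.conductorNorm ℤ → Squarefree d → 1 < d → (∀ q : ℕ, q.Prime → Literature.NumberTheory.EllipticCurves.BurungaleSkinnerTianWan2024.RamifiedInQuadratic d q → q ≠ p ∧ ¬ q ∣ N ∧ ¬ (q : ℤ) ∣ NumberField.discr K) → C • W' = W.quadraticTwist (d : ℚ) → Literature.NumberTheory.EllipticCurves.IsImaginaryQuadratic K → ((Ideal.span {(p : ℤ)}).primesOver (NumberField.RingOfIntegers K)).ncard = 2 → ((p : ℕ) : NumberField.RingOfIntegers K) ∈ v.asIdeal → ((p : ℕ) : NumberField.RingOfIntegers K) ∈ vbar.asIdeal → vbar ≠ v → (∀ (w : NumberField.InfinitePlace K) (k : NumberField.RingOfIntegers K), k ∈ v.asIdeal ↔ ‖ι.symm (w.embedding (k : K))‖ < 1) → IsCoprime (N : ℤ) (NumberField.discr K) → (∀ ρ : Literature.NumberTheory.GaloisRepresentations.ModPGaloisRep K (ZMod p) 2, (W.baseChange K).IsTorsionGaloisRep p ρ → Literature.NumberTheory.GaloisRepresentations.FramedRep.IsAbsolutelyIrreducible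 ρ) → κ₁.IsCyclotomic → κ₂.IsAnticyclotomic → (∀ ℓ : ℕ, ℓ.Prime → ℓ ∣ N → ((Ideal.span {(ℓ : ℤ)}).primesOver (NumberField.RingOfIntegers K)).ncard = 2) → ((Ideal.span {(2 : ℤ)}).primesOver (NumberField.RingOfIntegers K)).ncard = 2 → (Odd (NumberField.discr K) ∧ NumberField.discr K ≠ -3) → d % 8 = 1 → (∀ ℓ : ℕ, ℓ.Prime → (ℓ : ℤ) ∣ d → ((Ideal.span {(ℓ : ℤ)}).primesOver (NumberField.RingOfIntegers K)).ncard = 2) → (((d : ℤ) : ZMod p) ≠ 0 ∧ IsSquare ((d : ℤ) : ZMod p)) → (∀ ℓ : ℕ, ℓ.Prime → ℓ ∣ N → ℓ ≠ 2 → ((d : ℤ) : ZMod ℓ) ≠ 0 ∧ (IsSquare ((d : ℤ) : ZMod ℓ) ↔ ¬ p ∣ ℓ + 1)) → ∀ (Ω δ : ℂ) (Ωp : (Literature.NumberTheory.EllipticCurves.unrIntegers p)ˣ) (LK G G' : PowerSeries (PowerSeries (PadicComplexInt p))), Ω ≠ 0 → (δ ^ 2 = (NumberField.discr K : ℂ)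 ∨ δ ^ 2 = -(NumberField.discr K : ℂ)) → Literature.NumberTheory.EllipticCurves.IsKatzMeasure₂ ι v vbar ∅ κ₁ κ₂ γ₁⁻¹ γ₂⁻¹ 1 Ω δ ((Ωp : Literature.NumberTheory.EllipticCurves.unrIntegers p) : PadicComplex p) LK → Literature.NumberTheory.EllipticCurves.IsGreenbergLFunctionAnyRoot₂ ι v vbar κ₁ κ₂ γ₁⁻¹ γ₂⁻¹ f (NumberField.discr K).natAbs (NumberField.classNumber K) LK G → Literature.NumberTheory.EllipticCurves.IsGreenbergLFunctionAnyRoot₂ ι v vbar κ₁ κ₂ γ₁⁻¹ γ₂⁻¹ f' (NumberField.discr K).natAbs (NumberField.classNumber K) LK G' → ∀ J : ℤ_[p] →+* PadicComplexInt p, (∀ x : ℤ_[p], ((J x : PadicComplexInt p) : PadicComplex p) = ((x : ℚ_[p]) : PadicComplex p)) → ∃ s : PowerSeries (PadicComplexInt p), s ≠ 0 ∧ Ideal.span {PowerSeries.map (PowerSeries.C (R := PadicComplexInt p)) s} * ((WeierstrassCurve.XGr₂.charIdeal (W.baseChange K) p κ₁ κ₂ vbar γ₁ γ₂).map (Literature.NumberTheory.EllipticCurves.IwasawaAlgebra₂.toUnr₂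 p J) * (WeierstrassCurve.XGr₂.charIdeal (W'.baseChange K) p κ₁ κ₂ vbar γ₁ γ₂).map (Literature.NumberTheory.EllipticCurves.IwasawaAlgebra₂.toUnr₂ p J)) ≤ Ideal.span {G * G'} := by
  intro W _ _ p _ hp hX hs K _ _ ι v vbar κ₁ κ₂ γ₁ γ₂ _ _ N _ f d W' _ _ C N' _ f' h0 h1 h2 h3 _h4 h5 h6 h7 h8
    h9 h10 h11 h12 h13 h14 _h15 h16 h17 _e1 _e2 e3 _e4 _e5 _e6 _e7 Ω δ Ωp LK G G' hΩ hδ hLK hG hG' J hJ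
  have hpP : p.Prime := Fact.out
  have hp2 : p ≠ 2 := by omega
  have hpN : ¬ p ∣ N := by
    have hNn : N = W.conductorNorm ℤ := by exact_mod_cast h1
    rw [hNn]
    exact not_dvd_conductorNorm_of_hasGoodReductionAtPrime W hX.1.1
  obtain ⟨hpN', h14'⟩ := twist_level_conditions hpP hp2 W W' h1 h3 hpN h5 h6 h7 h14 e3.1
  obtain ⟨s₁, hs₁, hA₁⟩ := hA p W K ι v vbar κ₁ κ₂ γ₁ γ₂ N f h0 h1 hp2 hpN h8 h9 h10 h11 h12 h13 h14 h16 h17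
    Ω δ Ωp LK G hΩ hδ hLK hG J hJ
  obtain ⟨s₂, hs₂, hA₂⟩ := hA p W' K ι v vbar κ₁ κ₂ γ₁ γ₂ N' f' h2 h3 hp2 hpN' h8 h9 h10 h11 h12 h13 h14' h16
    h17 Ω δ Ωp LK G' hΩ hδ hLK hG' J hJ
  refine ⟨s₁ * s₂, mul_ne_zero hs₁ hs₂, ?_⟩
  rw [map_mul, ← Ideal.span_singleton_mul_span_singleton, ← Ideal.span_singleton_mul_span_singleton,
    mul_mul_mul_comm]
  exact Ideal.mul_mono hA₁ hA₂

/-- **K1′ ⇐ the R3 item (`A.sig` text).** The closing shape for stmt-BirchSwinnertonDyer-20502 once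
`GreenbergLowerHalfConj912` is a route decl with body `A.sig`: `fun h ↦ twistPairGreenbergProductDivisibilitySplit_of_conj912 h`
(modulo the route namespace). Via the equivalence with §1's ordering and §1's glue. -/
theorem twistPairGreenbergProductDivisibilitySplit_of_conj912
    (hA : ∀ (p : ℕ) [Fact p.Prime] (W : WeierstrassCurve ℚ) [W.IsElliptic] [W.IsGloballyMinimal] (K : Type) [Field K] [NumberField K] (ι : PadicAlgCl p ≃+* ℂ) (v vbar : IsDedekindDomain.HeightOneSpectrum (NumberField.RingOfIntegers K)) (κ₁ κ₂ : Literature.NumberTheory.EllipticCurves.ZpExtension K p) (γ₁ γ₂ : Field.absoluteGaloisGroup K) [Fact (Literature.NumberTheory.EllipticCurves.ZpExtension.IsTopGeneratorPair κ₁ κ₂ γ₁ γ₂)] [NeZero (NumberField.discr K).natAbs] (N : ℕ) [NeZero N] (f : CuspForm (CongruenceSubgroup.Gamma0 N) 2), Literature.NumberTheory.EllipticCurves.ModularForms.IsNewformOf W f → (N : ℤ) = W.conductorNorm ℤ → p ≠ 2 → ¬ p ∣ N → Literature.NumberTheory.EllipticCurves.IsImaginaryQuadratic K → ((Ideal.span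 {(p : ℤ)}).primesOver (NumberField.RingOfIntegers K)).ncard = 2 → ((p : ℕ) : NumberField.RingOfIntegers K) ∈ v.asIdeal → ((p : ℕ) : NumberField.RingOfIntegers K) ∈ vbar.asIdeal → vbar ≠ v → (∀ (w : NumberField.InfinitePlace K) (k : NumberField.RingOfIntegers K), k ∈ v.asIdeal ↔ ‖ι.symm (w.embedding (k : K))‖ < 1) → IsCoprime (N : ℤ) (NumberField.discr K) → κ₁.IsCyclotomic → κ₂.IsAnticyclotomic → ∀ (Ω δ : ℂ) (Ωp : (Literature.NumberTheory.EllipticCurves.unrIntegers p)ˣ) (LK G : PowerSeries (PowerSeries (PadicComplexInt p))), Ω ≠ 0 → (δ ^ 2 = (NumberField.discr K : ℂ) ∨ δ ^ 2 = -(NumberField.discr K : ℂ)) → Literature.NumberTheory.EllipticCurves.IsKatzMeasure₂ ι v vbar ∅ κ₁ κ₂ γ₁⁻¹ γ₂⁻¹ 1 Ω δ ((Ωp : Literature.NumberTheory.EllipticCurves.unrIntegers p) : PadicComplex p) LK → Literature.NumberTheory.EllipticCurves.IsGreenbergLFunctionAnyRoot₂ ι v vbar κ₁ κ₂ γ₁⁻¹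 γ₂⁻¹ f (NumberField.discr K).natAbs (NumberField.classNumber K) LK G → ∀ J : ℤ_[p] →+* PadicComplexInt p, (∀ x : ℤ_[p], ((J x : PadicComplexInt p) : PadicComplex p) = ((x : ℚ_[p]) : PadicComplex p)) → ∃ s : PowerSeries (PadicComplexInt p), s ≠ 0 ∧ Ideal.span {PowerSeries.map (PowerSeries.C (R := PadicComplexInt p)) s} * (WeierstrassCurve.XGr₂.charIdeal (W.baseChange K) p κ₁ κ₂ vbar γ₁ γ₂).map (Literature.NumberTheory.EllipticCurves.IwasawaAlgebra₂.toUnr₂ p J) ≤ Ideal.span {G}) :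
    TwistPairGreenbergProductDivisibilitySplit :=
  twistPairGreenbergProductDivisibilitySplit_of_greenbergLowerHalf (greenbergLowerHalf_of_conj912 hA)

/-- **Currency certificate: the R3 item implies the tree's typed Thm. 9.24 first-clause OPEN binder**
(`thm924_greenberg_dvd_charIdealXGr₂_awayFromCyc_OPEN`) — it is that binder with the antecedents `Squarefree N`,
(irr_L), (spl) and `2 split ∨ 2 ∣ N` removed, nothing else changed. (Planner's `R3Glue.thm924_firstClause_of_conj912`.) -/
theorem thm924_firstClause_of_conj912
    (hA : ∀ (p : ℕ) [Fact p.Prime] (W : WeierstrassCurve ℚ) [W.IsElliptic] [W.IsGloballyMinimal] (K : Type) [Field K] [NumberField K] (ι : PadicAlgCl p ≃+* ℂ) (v vbar : IsDedekindDomain.HeightOneSpectrum (NumberField.RingOfIntegers K)) (κ₁ κ₂ : Literature.NumberTheory.EllipticCurves.ZpExtension K p) (γ₁ γ₂ : Field.absoluteGaloisGroup K) [Fact (Literature.NumberTheory.EllipticCurves.ZpExtension.IsTopGeneratorPair κ₁ κ₂ γ₁ γ₂)] [NeZero (NumberField.discr K).natAbs] (N : ℕ) [NeZero N] (f : CuspForm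 (CongruenceSubgroup.Gamma0 N) 2), Literature.NumberTheory.EllipticCurves.ModularForms.IsNewformOf W f → (N : ℤ) = W.conductorNorm ℤ → p ≠ 2 → ¬ p ∣ N → Literature.NumberTheory.EllipticCurves.IsImaginaryQuadratic K → ((Ideal.span {(p : ℤ)}).primesOver (NumberField.RingOfIntegers K)).ncard = 2 → ((p : ℕ) : NumberField.RingOfIntegers K) ∈ v.asIdeal → ((p : ℕ) : NumberField.RingOfIntegers K) ∈ vbar.asIdeal → vbar ≠ v → (∀ (w : NumberField.InfinitePlace K) (k : NumberField.RingOfIntegers K), k ∈ v.asIdeal ↔ ‖ι.symm (w.embedding (k : K))‖ < 1) → IsCoprime (N : ℤ) (NumberField.discr K) → κ₁.IsCyclotomic → κ₂.IsAnticyclotomic → ∀ (Ω δ : ℂ) (Ωp : (Literature.NumberTheory.EllipticCurves.unrIntegers p)ˣ) (LK G : PowerSeries (PowerSeries (PadicComplexInt p))), Ω ≠ 0 → (δ ^ 2 = (NumberField.discr K : ℂ) ∨ δ ^ 2 = -(NumberField.discr K : ℂ)) → Literature.NumberTheory.EllipticCurves.IsKatzMeasure₂ ι v vbar ∅ κ₁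 κ₂ γ₁⁻¹ γ₂⁻¹ 1 Ω δ ((Ωp : Literature.NumberTheory.EllipticCurves.unrIntegers p) : PadicComplex p) LK → Literature.NumberTheory.EllipticCurves.IsGreenbergLFunctionAnyRoot₂ ι v vbar κ₁ κ₂ γ₁⁻¹ γ₂⁻¹ f (NumberField.discr K).natAbs (NumberField.classNumber K) LK G → ∀ J : ℤ_[p] →+* PadicComplexInt p, (∀ x : ℤ_[p], ((J x : PadicComplexInt p) : PadicComplex p) = ((x : ℚ_[p]) : PadicComplex p)) → ∃ s : PowerSeries (PadicComplexInt p), s ≠ 0 ∧ Ideal.span {PowerSeries.map (PowerSeries.C (R := PadicComplexInt p)) s} * (WeierstrassCurve.XGr₂.charIdeal (W.baseChange K) p κ₁ κ₂ vbar γ₁ γ₂).map (Literature.NumberTheory.EllipticCurves.IwasawaAlgebra₂.toUnr₂ p J) ≤ Ideal.span {G}) :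
    Literature.NumberTheory.EllipticCurves.BurungaleSkinnerTianWan2024.thm924_greenberg_dvd_charIdealXGr₂_awayFromCyc_OPEN := by
  intro p _ ι W _ _ K _ _ v vbar κ₁ κ₂ γ₁ γ₂ _ N _ f hf _ hN _ hp2 hpN hK hsplit hv hvbar hvv hι hcop _ _ _ hκ₁ hκ₂
    Ω δ Ωp LK G hΩ hδ hLK hG J hJ
  exact hA p W K ι v vbar κ₁ κ₂ γ₁ γ₂ N f hf hN hp2 hpN hK hsplit hv hvbar hvv hι hcop hκ₁ hκ₂ Ω δ Ωp LK G hΩ hδ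
    hLK hG J hJ

/-! ### §3 (appended by the same seat, sbc-p1 g4, on the tenure planner's ask bsd-wall-ss g4 12:48:17Z): the same glue
### for the freeze-end re-statement K1″ = K1′ + «γ₁ canonical»

The certified freeze-end package `HOME/bsd-wall-ss/rev14/` (README-rev14 c5a91f6bfd6e7de3; applies 2026-08-28T09:11Z)
re-states the deciding crux as **K1″ `TwistPairGreenbergProductDivisibilityCanonical`** (K1can.sig, 3 871 chars = K1′'s
text with the conjunct `∃ ζ : ℤ_pˣ, IsOfFinOrder ζ ∧ χ_cyc(γ₁)·ζ = cyclotomicGenerator p` inserted right after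
`κ₁.IsCyclotomic ∧ κ₂.IsAnticyclotomic ∧`; K1′ 20502 becomes an aside, decl kept), and the R3 split is re-based on
K1″ (`HOME/bsd-wall-ss/rev15-R3b/`: children `GreenbergLowerHalfConj912` = A.sig UNCHANGED and FD″ =
`TwistPairFrameDataCanonical` = FD2.sig). FD″ is PROVED verbatim in the route-independent module
`SignedBaseChangeTwistPairGreenbergProductDivisibilityCanonicalFrameData` (`stub_frameDataBCSsplit_canonical`).
§3 lands the two remaining one-liners-to-be: K1″ (text VERBATIM as the conclusion) ⇐ A.sig
(`twistPairGreenbergProductDivisibilityCanonical_of_conj912`; at apply time the glue item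
`GreenbergLowerHalfConj912 → TwistPairFrameDataCanonical → TwistPairGreenbergProductDivisibilityCanonical` closes by
`fun hA _ ↦ twistPairGreenbergProductDivisibilityCanonical_of_conj912 hA`), and the aside K1′ ⇐ K1″
(`twistPairGreenbergProductDivisibilitySplit_of_canonical`, drop the conjunct; = the planner's Sketch14
`k1split_of_k1canonical`), so that 20502 closes the moment K1″ does. Nothing here asserts the conjecture. -/

/-- **K1″ ⇐ the R3 item (`A.sig`).** Conclusion = HOME/bsd-wall-ss/rev14/K1can.sig VERBATIM (the text rev 14′ files
as `TwistPairGreenbergProductDivisibilityCanonical`): FD″ (`stub_frameDataBCSsplit_canonical`) supplies the witnesses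
including the canonical `γ₁`, and `productDivisibilityBCSsplit_of_conj912` (§2) the divisibility conjunct; tuple
order `…, h14, e1, e5, e2, h15, h16, h17, hcan, PD` (planner's R3Glue2 `…Canonical_of_children`). -/
theorem twistPairGreenbergProductDivisibilityCanonical_of_conj912
    (hA : ∀ (p : ℕ) [Fact p.Prime] (W : WeierstrassCurve ℚ) [W.IsElliptic] [W.IsGloballyMinimal] (K : Type) [Field K] [NumberField K] (ι : PadicAlgCl p ≃+* ℂ) (v vbar : IsDedekindDomain.HeightOneSpectrum (NumberField.RingOfIntegers K)) (κ₁ κ₂ : Literature.NumberTheory.EllipticCurves.ZpExtension K p) (γ₁ γ₂ : Field.absoluteGaloisGroup K) [Fact (Literature.NumberTheory.EllipticCurves.ZpExtension.IsTopGeneratorPair κ₁ κ₂ γ₁ γ₂)] [NeZero (NumberField.discr K).natAbs] (N : ℕ) [NeZero N] (f : CuspForm (CongruenceSubgroup.Gamma0 N) 2), Literature.NumberTheory.EllipticCurves.ModularForms.IsNewformOf W f → (N : ℤ) = W.conductorNorm ℤ → p ≠ 2 → ¬ p ∣ N → Literature.NumberTheory.EllipticCurves.IsImaginaryQuadratic K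 → ((Ideal.span {(p : ℤ)}).primesOver (NumberField.RingOfIntegers K)).ncard = 2 → ((p : ℕ) : NumberField.RingOfIntegers K) ∈ v.asIdeal → ((p : ℕ) : NumberField.RingOfIntegers K) ∈ vbar.asIdeal → vbar ≠ v → (∀ (w : NumberField.InfinitePlace K) (k : NumberField.RingOfIntegers K), k ∈ v.asIdeal ↔ ‖ι.symm (w.embedding (k : K))‖ < 1) → IsCoprime (N : ℤ) (NumberField.discr K) → κ₁.IsCyclotomic → κ₂.IsAnticyclotomic → ∀ (Ω δ : ℂ) (Ωp : (Literature.NumberTheory.EllipticCurves.unrIntegers p)ˣ) (LK G : PowerSeries (PowerSeries (PadicComplexInt p))), Ω ≠ 0 → (δ ^ 2 = (NumberField.discr K : ℂ) ∨ δ ^ 2 = -(NumberField.discr K : ℂ)) → Literature.NumberTheory.EllipticCurves.IsKatzMeasure₂ ι v vbar ∅ κ₁ κ₂ γ₁⁻¹ γ₂⁻¹ 1 Ω δ ((Ωp : Literature.NumberTheory.EllipticCurves.unrIntegers p) : PadicComplex p) LK → Literature.NumberTheory.EllipticCurves.IsGreenbergLFunctionAnyRoot₂ ι v vbar κ₁ κ₂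 γ₁⁻¹ γ₂⁻¹ f (NumberField.discr K).natAbs (NumberField.classNumber K) LK G → ∀ J : ℤ_[p] →+* PadicComplexInt p, (∀ x : ℤ_[p], ((J x : PadicComplexInt p) : PadicComplex p) = ((x : ℚ_[p]) : PadicComplex p)) → ∃ s : PowerSeries (PadicComplexInt p), s ≠ 0 ∧ Ideal.span {PowerSeries.map (PowerSeries.C (R := PadicComplexInt p)) s} * (WeierstrassCurve.XGr₂.charIdeal (W.baseChange K) p κ₁ κ₂ vbar γ₁ γ₂).map (Literature.NumberTheory.EllipticCurves.IwasawaAlgebra₂.toUnr₂ p J) ≤ Ideal.span {G}) :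
    Literature.NumberTheory.EllipticCurves.ModularForms.nonempty_modularParametrizationData → ∀ (W : WeierstrassCurve ℚ) [W.IsElliptic] [W.IsGloballyMinimal] (p : ℕ) [Fact p.Prime], 5 ≤ p → Literature.NumberTheory.EllipticCurves.Rank1Residual.ClassX7 W p → Literature.NumberTheory.EllipticCurves.Rank1Residual.Surj W p → ∃ (K : Type) (_ : Field K) (_ : NumberField K) (ι : PadicAlgCl p ≃+* ℂ) (v vbar : IsDedekindDomain.HeightOneSpectrum (NumberField.RingOfIntegers K)) (κ₁ κ₂ : Literature.NumberTheory.EllipticCurves.ZpExtension K p) (γ₁ γ₂ : Field.absoluteGaloisGroup K) (_ : Fact (Literature.NumberTheory.EllipticCurves.ZpExtension.IsTopGeneratorPair κ₁ κ₂ γ₁ γ₂)) (_ : NeZero (NumberField.discr K).natAbs) (N : ℕ) (_ : NeZero N) (f : CuspForm (CongruenceSubgroup.Gamma0 N) 2) (d : ℤ) (W' : WeierstrassCurve ℚ) (_ : W'.IsElliptic) (_ : W'.IsGloballyMinimal) (C : WeierstrassCurve.VariableChange ℚ) (N' : ℕ) (_ : NeZero N') (f' : CuspForm (CongruenceSubgroup.Gamma0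 N') 2), Literature.NumberTheory.EllipticCurves.ModularForms.IsNewformOf W f ∧ (N : ℤ) = W.conductorNorm ℤ ∧ Literature.NumberTheory.EllipticCurves.ModularForms.IsNewformOf W' f' ∧ (N' : ℤ) = W'.conductorNorm ℤ ∧ Squarefree d ∧ 1 < d ∧ (∀ q : ℕ, q.Prime → Literature.NumberTheory.EllipticCurves.BurungaleSkinnerTianWan2024.RamifiedInQuadratic d q → q ≠ p ∧ ¬ q ∣ N ∧ ¬ (q : ℤ) ∣ NumberField.discr K) ∧ C • W' = W.quadraticTwist (d : ℚ) ∧ Literature.NumberTheory.EllipticCurves.IsImaginaryQuadratic K ∧ ((Ideal.span {(p : ℤ)}).primesOver (NumberField.RingOfIntegers K)).ncard = 2 ∧ ((p : ℕ) : NumberField.RingOfIntegers K) ∈ v.asIdeal ∧ ((p : ℕ) : NumberField.RingOfIntegers K) ∈ vbar.asIdeal ∧ vbar ≠ v ∧ (∀ (w : NumberField.InfinitePlace K) (k : NumberField.RingOfIntegers K), k ∈ v.asIdeal ↔ ‖ι.symm (w.embedding (k : K))‖ < 1) ∧ IsCoprime (N : ℤ) (NumberField.discr K) ∧ (∀ ℓ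 : ℕ, ℓ.Prime → ℓ ∣ N → ((Ideal.span {(ℓ : ℤ)}).primesOver (NumberField.RingOfIntegers K)).ncard = 2) ∧ (∀ ℓ : ℕ, ℓ.Prime → (ℓ : ℤ) ∣ d → ((Ideal.span {(ℓ : ℤ)}).primesOver (NumberField.RingOfIntegers K)).ncard = 2) ∧ ((Ideal.span {(2 : ℤ)}).primesOver (NumberField.RingOfIntegers K)).ncard = 2 ∧ (∀ ρ : Literature.NumberTheory.GaloisRepresentations.ModPGaloisRep K (ZMod p) 2, (W.baseChange K).IsTorsionGaloisRep p ρ → Literature.NumberTheory.GaloisRepresentations.FramedRep.IsAbsolutelyIrreducible ρ) ∧ κ₁.IsCyclotomic ∧ κ₂.IsAnticyclotomic ∧ (∃ ζ : ℤ_[p]ˣ, IsOfFinOrder ζ ∧ ((Literature.NumberTheory.GaloisRepresentations.GaloisRep.cyclotomicCharacter K p γ₁ * ζ : ℤ_[p]ˣ) : ℤ_[p]) = (Literature.NumberTheory.EllipticCurves.cyclotomicGenerator p : ℤ_[p])) ∧ ∀ (Ω δ : ℂ) (Ωp : (Literature.NumberTheory.EllipticCurves.unrIntegers p)ˣ) (LK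 G G' : PowerSeries (PowerSeries (PadicComplexInt p))), Ω ≠ 0 → (δ ^ 2 = (NumberField.discr K : ℂ) ∨ δ ^ 2 = -(NumberField.discr K : ℂ)) → Literature.NumberTheory.EllipticCurves.IsKatzMeasure₂ ι v vbar ∅ κ₁ κ₂ γ₁⁻¹ γ₂⁻¹ 1 Ω δ ((Ωp : Literature.NumberTheory.EllipticCurves.unrIntegers p) : PadicComplex p) LK → Literature.NumberTheory.EllipticCurves.IsGreenbergLFunctionAnyRoot₂ ι v vbar κ₁ κ₂ γ₁⁻¹ γ₂⁻¹ f (NumberField.discr K).natAbs (NumberField.classNumber K) LK G → Literature.NumberTheory.EllipticCurves.IsGreenbergLFunctionAnyRoot₂ ι v vbar κ₁ κ₂ γ₁⁻¹ γ₂⁻¹ f' (NumberField.discr K).natAbs (NumberField.classNumber K) LK G' → ∀ J : ℤ_[p] →+* PadicComplexInt p, (∀ x : ℤ_[p], ((J x : PadicComplexInt p) : PadicComplex p) = ((x : ℚ_[p]) : PadicComplex p)) → ∃ s : PowerSeries (PadicComplexInt p), s ≠ 0 ∧ Ideal.span {PowerSeries.map (PowerSeries.C (R := PadicComplexInt p))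 s} * ((WeierstrassCurve.XGr₂.charIdeal (W.baseChange K) p κ₁ κ₂ vbar γ₁ γ₂).map (Literature.NumberTheory.EllipticCurves.IwasawaAlgebra₂.toUnr₂ p J) * (WeierstrassCurve.XGr₂.charIdeal (W'.baseChange K) p κ₁ κ₂ vbar γ₁ γ₂).map (Literature.NumberTheory.EllipticCurves.IwasawaAlgebra₂.toUnr₂ p J)) ≤ Ideal.span {G * G'} := by
  intro hmodP W _ _ p _ hp hX hs
  obtain ⟨K, iF, iNF, ι, v, vbar, κ₁, κ₂, γ₁, γ₂, iPair, iD, N, iN, f, d, W', iE', iM', C, N', iN', f', h0, h1,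
      h2, h3, h4, h5, h6, h7, h8, h9, h10, h11, h12, h13, h14, h15, h16, h17, hcan, e1, e2, e3, e4, e5, e6, e7⟩ :=
    Summit.BirchSwinnertonDyer.BirchSwinnertonDyer.Theorems.SignedBaseChangeK1FrameDataCanonical.stub_frameDataBCSsplit_canonical
      hmodP W p hp hX hs
  exact ⟨K, iF, iNF, ι, v, vbar, κ₁, κ₂, γ₁, γ₂, iPair, iD, N, iN, f, d, W', iE', iM', C, N', iN', f', h0, h1,
    h2, h3, h4, h5, h6, h7, h8, h9, h10, h11, h12, h13, h14, e1, e5, e2, h15, h16, h17, hcan,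
    productDivisibilityBCSsplit_of_conj912 hA W p hp hX hs K ι v vbar κ₁ κ₂ γ₁ γ₂ N f d W' C N' f' h0 h1 h2 h3
      h4 h5 h6 h7 h8 h9 h10 h11 h12 h13 h14 h15 h16 h17 e1 e2 e3 e4 e5 e6 e7⟩

/-- **The aside K1′ ⇐ K1″** (drop the «γ₁ canonical» conjunct; hypothesis = K1can.sig VERBATIM): after rev 14′ the
decl `TwistPairGreenbergProductDivisibilitySplit` (stmt-BirchSwinnertonDyer-20502, then an aside) closes the moment
K1″ does. (= the planner's Sketch14 `k1split_of_k1canonical`.) -/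
theorem twistPairGreenbergProductDivisibilitySplit_of_canonical
    (hK1 : Literature.NumberTheory.EllipticCurves.ModularForms.nonempty_modularParametrizationData → ∀ (W : WeierstrassCurve ℚ) [W.IsElliptic] [W.IsGloballyMinimal] (p : ℕ) [Fact p.Prime], 5 ≤ p → Literature.NumberTheory.EllipticCurves.Rank1Residual.ClassX7 W p → Literature.NumberTheory.EllipticCurves.Rank1Residual.Surj W p → ∃ (K : Type) (_ : Field K) (_ : NumberField K) (ι : PadicAlgCl p ≃+* ℂ) (v vbar : IsDedekindDomain.HeightOneSpectrum (NumberField.RingOfIntegers K)) (κ₁ κ₂ : Literature.NumberTheory.EllipticCurves.ZpExtension K p) (γ₁ γ₂ : Field.absoluteGaloisGroup K) (_ : Fact (Literature.NumberTheory.EllipticCurves.ZpExtension.IsTopGeneratorPair κ₁ κ₂ γ₁ γ₂)) (_ : NeZero (NumberField.discr K).natAbs) (N : ℕ) (_ : NeZero N) (f : CuspForm (CongruenceSubgroup.Gamma0 N) 2) (d : ℤ) (W' : WeierstrassCurve ℚ) (_ : W'.IsElliptic) (_ : W'.IsGloballyMinimal) (C : WeierstrassCurve.VariableChange ℚ) (N'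 : ℕ) (_ : NeZero N') (f' : CuspForm (CongruenceSubgroup.Gamma0 N') 2), Literature.NumberTheory.EllipticCurves.ModularForms.IsNewformOf W f ∧ (N : ℤ) = W.conductorNorm ℤ ∧ Literature.NumberTheory.EllipticCurves.ModularForms.IsNewformOf W' f' ∧ (N' : ℤ) = W'.conductorNorm ℤ ∧ Squarefree d ∧ 1 < d ∧ (∀ q : ℕ, q.Prime → Literature.NumberTheory.EllipticCurves.BurungaleSkinnerTianWan2024.RamifiedInQuadratic d q → q ≠ p ∧ ¬ q ∣ N ∧ ¬ (q : ℤ) ∣ NumberField.discr K) ∧ C • W' = W.quadraticTwist (d : ℚ) ∧ Literature.NumberTheory.EllipticCurves.IsImaginaryQuadratic K ∧ ((Ideal.span {(p : ℤ)}).primesOver (NumberField.RingOfIntegers K)).ncard = 2 ∧ ((p : ℕ) : NumberField.RingOfIntegers K) ∈ v.asIdeal ∧ ((p : ℕ) : NumberField.RingOfIntegers K) ∈ vbar.asIdeal ∧ vbar ≠ v ∧ (∀ (w : NumberField.InfinitePlace K) (k : NumberField.RingOfIntegers K), k ∈ v.asIdeal ↔ ‖ι.symm (w.embedding (k : K))‖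 < 1) ∧ IsCoprime (N : ℤ) (NumberField.discr K) ∧ (∀ ℓ : ℕ, ℓ.Prime → ℓ ∣ N → ((Ideal.span {(ℓ : ℤ)}).primesOver (NumberField.RingOfIntegers K)).ncard = 2) ∧ (∀ ℓ : ℕ, ℓ.Prime → (ℓ : ℤ) ∣ d → ((Ideal.span {(ℓ : ℤ)}).primesOver (NumberField.RingOfIntegers K)).ncard = 2) ∧ ((Ideal.span {(2 : ℤ)}).primesOver (NumberField.RingOfIntegers K)).ncard = 2 ∧ (∀ ρ : Literature.NumberTheory.GaloisRepresentations.ModPGaloisRep K (ZMod p) 2, (W.baseChange K).IsTorsionGaloisRep p ρ → Literature.NumberTheory.GaloisRepresentations.FramedRep.IsAbsolutelyIrreducible ρ) ∧ κ₁.IsCyclotomic ∧ κ₂.IsAnticyclotomic ∧ (∃ ζ : ℤ_[p]ˣ, IsOfFinOrder ζ ∧ ((Literature.NumberTheory.GaloisRepresentations.GaloisRep.cyclotomicCharacter K p γ₁ * ζ : ℤ_[p]ˣ) : ℤ_[p]) = (Literature.NumberTheory.EllipticCurves.cyclotomicGenerator p : ℤ_[p])) ∧ ∀ (Ω δ : ℂ)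 (Ωp : (Literature.NumberTheory.EllipticCurves.unrIntegers p)ˣ) (LK G G' : PowerSeries (PowerSeries (PadicComplexInt p))), Ω ≠ 0 → (δ ^ 2 = (NumberField.discr K : ℂ) ∨ δ ^ 2 = -(NumberField.discr K : ℂ)) → Literature.NumberTheory.EllipticCurves.IsKatzMeasure₂ ι v vbar ∅ κ₁ κ₂ γ₁⁻¹ γ₂⁻¹ 1 Ω δ ((Ωp : Literature.NumberTheory.EllipticCurves.unrIntegers p) : PadicComplex p) LK → Literature.NumberTheory.EllipticCurves.IsGreenbergLFunctionAnyRoot₂ ι v vbar κ₁ κ₂ γ₁⁻¹ γ₂⁻¹ f (NumberField.discr K).natAbs (NumberField.classNumber K) LK G → Literature.NumberTheory.EllipticCurves.IsGreenbergLFunctionAnyRoot₂ ι v vbar κ₁ κ₂ γ₁⁻¹ γ₂⁻¹ f' (NumberField.discr K).natAbs (NumberField.classNumber K) LK G' → ∀ J : ℤ_[p] →+* PadicComplexInt p, (∀ x : ℤ_[p], ((J x : PadicComplexInt p) : PadicComplex p) = ((x : ℚ_[p]) : PadicComplex p)) → ∃ s : PowerSeries (PadicComplexInt p), s ≠ 0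 ∧ Ideal.span {PowerSeries.map (PowerSeries.C (R := PadicComplexInt p)) s} * ((WeierstrassCurve.XGr₂.charIdeal (W.baseChange K) p κ₁ κ₂ vbar γ₁ γ₂).map (Literature.NumberTheory.EllipticCurves.IwasawaAlgebra₂.toUnr₂ p J) * (WeierstrassCurve.XGr₂.charIdeal (W'.baseChange K) p κ₁ κ₂ vbar γ₁ γ₂).map (Literature.NumberTheory.EllipticCurves.IwasawaAlgebra₂.toUnr₂ p J)) ≤ Ideal.span {G * G'}) :
    TwistPairGreenbergProductDivisibilitySplit := by
  intro hmodP W _ _ p _ hp hX hs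
  obtain ⟨K, iF, iNF, ι, v, vbar, κ₁, κ₂, γ₁, γ₂, iPair, iD, N, iN, f, d, W', iE', iM', C, N', iN', f', h0, h1,
      h2, h3, h4, h5, h6, h7, h8, h9, h10, h11, h12, h13, h14, e1, e5, e2, h15, h16, h17, -, hPD⟩ :=
    hK1 hmodP W p hp hX hs
  exact ⟨K, iF, iNF, ι, v, vbar, κ₁, κ₂, γ₁, γ₂, iPair, iD, N, iN, f, d, W', iE', iM', C, N', iN', f', h0, h1,
    h2, h3, h4, h5, h6, h7, h8, h9, h10, h11, h12, h13, h14, e1, e5, e2, h15, h16, h17, hPD⟩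

end Summit.BirchSwinnertonDyer.BirchSwinnertonDyer.Theorems.SignedBaseChangeK1GlueR3
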